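import Literature.MathematicalPhysics.QuantumFieldTheory.Balaban1983to89.B13LocEAnalytic
import Literature.Probability.LatticeModels.PolymerGasRatio
import HarnessLib

/-!
# PARAMETER-ANALYTICITY OF THE KOTECKÝ–PREISS CLUSTER FUNCTIONALS `polymerLogZ`, `truncatedWeight` (`Φ^T`) AND `HsharpL` (`H♯`) UNDER A
# PARAMETER-UNIFORM KP CONDITION — the generic brick behind POLYᵃ∘'s clause (iii) for the terms `T Y := H♯(Y)` of the Mayer gas
# (crux `FluctuationComparisonRegPrIntL`, stmt-QuantumFields-20520; LINE g24-3 «polymer_form», LEAD w3-20520 g20's chain POLYᵃ∘ → POLYᵗ∘ → POLYⁿ∘ → POLY∘ → S2β)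

Cell `ym3-torus` (YM ladder rung R3 = continuum `SU(2)` Yang–Mills on the three-torus — a RUNG, NOT d = 4, NOT infinite volume, NOT a mass gap, NOT Clay).  Width seat
`ym-ust-20520-w4` (gen 19); `--supports stmt-QuantumFields-20520 --as helper`, count-neutral, definition-free, default heartbeats; ABSTRACT polymer types only (no Bałaban
object, no `T3Family`).

WHAT.  POLYᵃ∘ (✓`…PolymerAnalyticKnit.polymerTreeCan_of_polymerAnalytic`'s binder) asks, for every term `T Y` of the localized sum and every one-bond window move `U ↦ V`,
for a function `g` complex-differentiable on a disc with `g 0 = T Y U`, `g 1 = T Y V` (and a disc bound).  When `T Y := H♯(Y)(w(U))` is the cluster functional of a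
hard-core polymer gas whose ACTIVITIES `w X` are boundary values of analytic one-bond interpolants `v z X` (Kotecký–Preiss small uniformly in the parameter), the
interpolant of the TERM is `z ↦ H♯(Y)(v z)` — provided that map is complex-differentiable.  [KoteckyPreiss1986] p.493: «both `Z(V)` and `Φ^T(C)` are analytic» in the
activities; the tree has the one-volume parameter statement ✓`PolymerPressureAnalytic.differentiableOn_polymerLogZ_param` (hypothesis: ray zero-freeness).  The Literature module
`B13LocEAnalytic` (pub-balaban's D4 row) already proves the Banach-parameter holomorphy of `Φ^T(C)` and of Bałaban's localized sum `locE` (2.13); this file REUSES it and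
discharges the ray zero-freeness from a parameter-uniform KP condition (`‖u·v‖ ≤ ‖v‖` for `u ∈ [0,1]`, ✓`IsKPVolume.of_norm_le`, ✓`.mono`,
✓`polymerPartitionFunction_ne_zero_of_kp`) and pushes differentiability through the two FINITE sums: the Möbius sum `Φ^T(C) = Σ_{B ⊆ C} (−1)^{|C∖B|} log Ξ(B)` and
`H♯(Y) = Σ_{𝒞 ⊆ L, ∪𝒞 = Y} Φ^T(𝒞)` ([Dimock2013BalabanII] App. F).
* §1 ★ `differentiableOn_polymerLogZ_param_of_kp` — `z ↦ log Ξ(B; v z)` is complex-differentiable on an open `U` when the activities are and `IsKPVolume inc (v z) a Λ` holds for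
  every `z ∈ U` (`B ⊆ Λ`); `differentiableOn_truncatedWeight_param_of_kp_subvolume` — the super-volume corollary of the LITERATURE lemma
  ✓`Literature.Probability.LatticeModels.differentiableOn_truncatedWeight_param_of_kp` (`B13LocEAnalytic`; reused, not restated).
* §2 ★★★ `differentiableOn_sum_truncatedWeight_param_of_kp` — the same for any FINITE SUM `Σ_{𝒞 ∈ S} Φ^T(𝒞)` over sub-volumes `𝒞 ⊆ Λ` — EXACTLY the shape of
  `ClusterExpansionByUnions.HsharpL Θ L w Y` (`unfold HsharpL; exact …` at `inc := IncΩ Θ` for a consumer importing that module — kept abstract here because the Dimock module is in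
  no `Summits` import closure ∕ not prebuilt on the farm at the time of writing), + the `powerset.filter` instance; ★★ `exists_analytic_interpolant_sum_truncatedWeight` — POLYᵃ∘'s
  clause-(iii) SHAPE for such a term: an interpolating activity family `v : ℂ → (P → ℂ)`, activity-wise differentiable on `ball 0 R`, KP-small there, joining `v 0` to `v 1`,
  yields `g := fun z => Σ Φ^T(𝒞)(v z)` differentiable on the disc with the two boundary values and the disc bound transported (`hB`); `differentiableOn_affine_activity`.
* §3 ★★★ `exists_analytic_interpolant_locE` + `norm_locE_sub_locE_le_of_interpolant` — the same packaging for BAŁABAN'S OWN term `E(X) = locE` of [Balaban1988RG2Cluster] (2.13)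
  over the Literature module `B13Resummation` (locality `locE_congr`, representation `logZ_eq_sum_locE`, KP `kp_condition`, decay `norm_locE_le`, holomorphy
  `B13LocEAnalytic.differentiableOn_locE_param_of_kp` — all BUILT), i.e. the Mayer-gas layer LEAD w3-20520 g20's (E) needs, in the farm's prebuilt closure.

HONEST SCOPE.  Generic Kotecký–Preiss∕Mathlib plumbing; nothing of Bałaban's is asserted or proved; POLYᵃ∘, the Mayer-gas step (E), POLYᵗ∘∕POLYⁿ∘∕POLY∘, S2β,
`FluctuationComparisonRegPrIntL` (20520) are NOT proved; no summit is proved by a helper; rung R3 = SU(2) YM₃ on T³ — NOT d = 4, NOT infinite volume, NOT a mass gap, NOT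
Clay.  Sorry-free, axioms standard.

References: R. Kotecký, D. Preiss, CMP **103** (1986) 491–498 [KoteckyPreiss1986] (Theorem p.492, analyticity remark p.493); J. Dimock, *The renormalization group according to
Bałaban II*, J. Math. Phys. **54** (2013) [Dimock2013BalabanII] (App. F); T. Bałaban, CMP **109** (1987) 249–301 [Balaban1987RG1] ((1.11)–(1.14) p.262).
-/

set_option autoImplicit false

noncomputable section

namespace Summit.QuantumFields.YangMills.Theorems.FluctuationComparisonRegPrIntLPolymerClusterAnalytic

open Set Filter Topology
open scoped BigOperators
open Literature.Probability.LatticeModels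

/-! ## §1 One volume: `log Ξ(B; v z)` and `Φ^T(C)(v z)` are complex-differentiable in `z` under a `z`-uniform KP condition -/

section OneVolume

variable {P : Type*} [DecidableEq P] {inc : P → P → Prop} [DecidableRel inc] [Std.Refl inc] [Std.Symm inc]
variable {E : Type*} [NormedAddCommGroup E] [NormedSpace ℂ E]

/-- ★ **`z ↦ log Ξ(B; v z)` IS COMPLEX-DIFFERENTIABLE UNDER A `z`-UNIFORM KP CONDITION**: activities differentiable on an open `U`, `IsKPVolume inc (v z) a Λ` for every
`z ∈ U`, `B ⊆ Λ` ⟹ `DifferentiableOn ℂ (fun z => polymerLogZ inc (v z) B) U` — the ray partition functions `Ξ(B; u·v z)`, `u ∈ [0,1]`, are zero-free by the KP theorem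
(✓`polymerPartitionFunction_ne_zero_of_kp`), which is the hypothesis of ✓`differentiableOn_polymerLogZ_param`. [cite: KoteckyPreiss1986, Theorem p.492 and p.493] -/
theorem differentiableOn_polymerLogZ_param_of_kp {v : E → P → ℂ} {a : P → ℝ} {Λ B : Finset P} (hB : B ⊆ Λ) {U : Set E} (hU : IsOpen U)
    (hv : ∀ γ ∈ Λ, DifferentiableOn ℂ (fun z => v z γ) U) (hKP : ∀ z ∈ U, IsKPVolume inc (v z) a Λ) :
    DifferentiableOn ℂ (fun z => polymerLogZ inc (v z) B) U := by
  refine differentiableOn_polymerLogZ_param B hU (fun γ hγ => hv γ (hB hγ)) fun z hz u hu => ?_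
  -- along the ray `u·v z`, `u ∈ [0,1]`, the volume stays KP (the condition only sees `‖·‖`), hence zero-free on `B ⊆ Λ`
  have hKPu : IsKPVolume inc (fun γ => (u : ℂ) * v z γ) a Λ := by
    refine (hKP z hz).of_norm_le fun γ _ => ?_
    rw [norm_mul, Complex.norm_real, Real.norm_eq_abs, abs_of_nonneg hu.1]
    exact mul_le_of_le_one_left (norm_nonneg _) hu.2
  exact polymerPartitionFunction_ne_zero_of_kp hKPu hB

/-- ★★ **`z ↦ Φ^T(C)(v z)` UNDER A `z`-UNIFORM KP CONDITION ON A SUPER-VOLUME `Λ ⊇ C`** — the super-volume corollary of the Literature lemma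
✓`Literature.Probability.LatticeModels.differentiableOn_truncatedWeight_param_of_kp` ([Balaban1983to89] `B13LocEAnalytic`, KP stated on `C` itself): KP is inherited by
sub-volumes (✓`IsKPVolume.mono`).  (Reused, not restated: the one-volume statement is the Literature's.) [cite: KoteckyPreiss1986, (3) p.491 and p.493] -/
theorem differentiableOn_truncatedWeight_param_of_kp_subvolume {v : E → P → ℂ} {a : P → ℝ} {Λ C : Finset P} (hC : C ⊆ Λ) {U : Set E} (hU : IsOpen U)
    (hv : ∀ γ ∈ Λ, DifferentiableOn ℂ (fun z => v z γ) U) (hKP : ∀ z ∈ U, IsKPVolume inc (v z) a Λ) :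
    DifferentiableOn ℂ (fun z => truncatedWeight inc (v z) C) U :=
  differentiableOn_truncatedWeight_param_of_kp C hU (fun γ hγ => hv γ (hC hγ)) fun z hz => (hKP z hz).mono hC

end OneVolume

/-! ## §2 Finite sums of truncated functionals over sub-volumes (the shape of `H♯(Y) = Σ_{𝒞 ⊆ L, ∪𝒞 = Y} Φ^T(𝒞)`), and POLYᵃ∘'s interpolant shape -/

section Sums

variable {P : Type*} [DecidableEq P] {inc : P → P → Prop} [DecidableRel inc] [Std.Refl inc] [Std.Symm inc]
variable {E : Type*} [NormedAddCommGroup E] [NormedSpace ℂ E]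

/-- ★★★ **A FINITE SUM OF TRUNCATED FUNCTIONALS OVER SUB-VOLUMES OF A `z`-UNIFORM KP VOLUME IS COMPLEX-DIFFERENTIABLE IN `z`**: for any finite family `S` of sub-volumes
`𝒞 ⊆ Λ`, `z ↦ Σ_{𝒞 ∈ S} Φ^T(𝒞)(v z)` is differentiable on `U`.  This is EXACTLY the shape of [Dimock2013BalabanII] App. F's cluster functional
`H♯(Y) = Σ_{𝒞 ⊆ L, ∪𝒞 = Y} Φ^T(𝒞)` (tree: `ClusterExpansionByUnions.HsharpL Θ L w Y := ∑ 𝒞 ∈ L.powerset with 𝒞.biUnion id = Y, truncatedWeight (IncΩ Θ) w 𝒞`), so a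
consumer importing that module gets `DifferentiableOn ℂ (fun z => HsharpL Θ L (v z) Y) U` by `unfold HsharpL; exact` this lemma at `inc := IncΩ Θ`,
`S := L.powerset.filter (·.biUnion id = Y)` (every member `⊆ L` by `Finset.mem_powerset`).  (Kept abstract here: the Dimock module is not imported by any `Summits` file and is
not in the farm's prebuilt closure at the time of writing.) [cite: KoteckyPreiss1986, p.493; Dimock2013BalabanII, App. F Theorem cluster3] -/
theorem differentiableOn_sum_truncatedWeight_param_of_kp {v : E → P → ℂ} {a : P → ℝ} {Λ : Finset P} (S : Finset (Finset P)) (hS : ∀ 𝒞 ∈ S, 𝒞 ⊆ Λ)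
    {U : Set E} (hU : IsOpen U) (hv : ∀ γ ∈ Λ, DifferentiableOn ℂ (fun z => v z γ) U) (hKP : ∀ z ∈ U, IsKPVolume inc (v z) a Λ) :
    DifferentiableOn ℂ (fun z => ∑ 𝒞 ∈ S, truncatedWeight inc (v z) 𝒞) U :=
  DifferentiableOn.fun_sum fun 𝒞 h𝒞 => differentiableOn_truncatedWeight_param_of_kp_subvolume (hS 𝒞 h𝒞) hU hv hKP

/-- The powerset-filter instance (the literal `HsharpL` index set: sub-families of `L` with a prescribed union, or any other decidable predicate on sub-families).
[cite: Dimock2013BalabanII, App. F Theorem cluster3] -/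
theorem differentiableOn_sum_powersetFilter_truncatedWeight_param_of_kp {v : E → P → ℂ} {a : P → ℝ} (Λ : Finset P) (p : Finset P → Prop) [DecidablePred p]
    {U : Set E} (hU : IsOpen U) (hv : ∀ γ ∈ Λ, DifferentiableOn ℂ (fun z => v z γ) U) (hKP : ∀ z ∈ U, IsKPVolume inc (v z) a Λ) :
    DifferentiableOn ℂ (fun z => ∑ 𝒞 ∈ Λ.powerset with p 𝒞, truncatedWeight inc (v z) 𝒞) U :=
  differentiableOn_sum_truncatedWeight_param_of_kp _ (fun _ h𝒞 => Finset.mem_powerset.1 (Finset.mem_filter.1 h𝒞).1) hU hv hKP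

/-- ★★ **POLYᵃ∘'s CLAUSE-(iii) SHAPE FOR A CLUSTER TERM `T := Σ_{𝒞 ∈ S} Φ^T(𝒞)`** (e.g. `T Y = H♯(Y)`): an activity family `v : ℂ → (P → ℂ)`, activity-wise complex-differentiable on
the disc `ball 0 R`, Kotecký–Preiss small there (`IsKPVolume inc (v z) a Λ` for every `z` in the disc), and with the term bounded by `M` on the disc (TRANSPORTED as the hypothesis
`hB` — e.g. from ✓`ClusterExpansionByUnions.norm_HsharpL_leY` at each `z`), yields the interpolant `g := fun z => Σ_{𝒞 ∈ S} Φ^T(𝒞)(v z)` between the two boundary activity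
families `v 0`, `v 1`: differentiable on the disc, `‖g z‖ ≤ M` there, `g 0`∕`g 1` the two boundary terms — the four conjuncts POLYᵃ∘ asks of `g`.
[cite: KoteckyPreiss1986, p.493; Balaban1987RG1, (1.11)-(1.14) p.262] -/
theorem exists_analytic_interpolant_sum_truncatedWeight {v : ℂ → P → ℂ} {a : P → ℝ} {Λ : Finset P} (S : Finset (Finset P)) (hS : ∀ 𝒞 ∈ S, 𝒞 ⊆ Λ) {R M : ℝ}
    (hv : ∀ γ ∈ Λ, DifferentiableOn ℂ (fun z => v z γ) (Metric.ball 0 R)) (hKP : ∀ z ∈ Metric.ball (0 : ℂ) R, IsKPVolume inc (v z) a Λ)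
    (hB : ∀ z ∈ Metric.ball (0 : ℂ) R, ‖∑ 𝒞 ∈ S, truncatedWeight inc (v z) 𝒞‖ ≤ M) :
    ∃ g : ℂ → ℂ, DifferentiableOn ℂ g (Metric.ball 0 R) ∧ (∀ z ∈ Metric.ball (0 : ℂ) R, ‖g z‖ ≤ M) ∧
      g 0 = ∑ 𝒞 ∈ S, truncatedWeight inc (v 0) 𝒞 ∧ g 1 = ∑ 𝒞 ∈ S, truncatedWeight inc (v 1) 𝒞 :=
  ⟨fun z => ∑ 𝒞 ∈ S, truncatedWeight inc (v z) 𝒞, differentiableOn_sum_truncatedWeight_param_of_kp S hS Metric.isOpen_ball hv hKP, hB, rfl, rfl⟩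

omit [DecidableEq P] in
/-- The affine one-bond interpolation of the ACTIVITIES is the standard instance: `v z γ := w₀ γ + z·(w₁ γ − w₀ γ)` is entire in `z` activity-wise with `v 0 = w₀`, `v 1 = w₁`
(for POLYᵃ∘ one rather interpolates the underlying bond variable and composes with print's analytic activities; this lemma only records that the affine family meets
the differentiability clause). [cite: KoteckyPreiss1986, p.493] -/
theorem differentiableOn_affine_activity (w₀ w₁ : P → ℂ) (γ : P) (U : Set ℂ) :
    DifferentiableOn ℂ (fun z : ℂ => w₀ γ + z * (w₁ γ - w₀ γ)) U :=
  ((differentiableOn_const _).add ((differentiableOn_id).mul (differentiableOn_const _)))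

end Sums

/-! ## §3 Bałaban's X-localized cluster sum (2.13) `locE` (Literature `B13Resummation`, BUILT on the farm): POLYᵃ∘'s interpolant shape -/

section LocE

open Literature.MathematicalPhysics.QuantumFieldTheory.Balaban1983to89.B13Resummation
open Literature.MathematicalPhysics.QuantumFieldTheory.Balaban1983to89.B13FamilySum

variable {Dom Cube : Type*} [DecidableEq Dom] [DecidableEq Cube] [Fintype Dom]
variable (ι : Dom → Dom → Prop) [DecidableRel ι] [Std.Refl ι] [Std.Symm ι]

/-- ★★★ **POLYᵃ∘'s CLAUSE-(iii) SHAPE FOR BAŁABAN'S TERM `E(X) := locE ι cubes (H ·) X`** ([Balaban1988RG2Cluster] (2.13); Literature ✓`B13Resummation.locE` with its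
LOCALITY ✓`locE_congr`, REPRESENTATION ✓`logZ_eq_sum_locE`, KP CONDITION ✓`kp_condition`, DECAY BOUND ✓`norm_locE_le` (2.39)–(2.41), and Banach-parameter HOLOMORPHY
✓`B13LocEAnalytic.differentiableOn_locE_param_of_kp` — ALL in the farm's BUILT closure, unlike the `Dimock2011to13.ClusterExpansionByUnions` twin `HsharpL`): an activity family
`H : ℂ → (Dom → ℂ)`, polymer-wise complex-differentiable on the disc `ball 0 R`, Kotecký–Preiss small there on the whole (finite) family of domains, with `‖E(X)(H z)‖ ≤ M` on the
disc (transported, e.g. from ✓`norm_locE_le` at each `z`), yields the interpolant `g := fun z => locE ι cubes (H z) X` with the four conjuncts POLYᵃ∘ asks of it.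
[cite: Balaban1988RG2Cluster, (2.13) p.14, p.15 and (2.39)-(2.41) p.21; KoteckyPreiss1986, p.493] -/
theorem exists_analytic_interpolant_locE (cubes : Dom → Finset Cube) {H : ℂ → Dom → ℂ} {a : Dom → ℝ} {R M : ℝ} (X : Finset Cube)
    (hH : ∀ Z, DifferentiableOn ℂ (fun z => H z Z) (Metric.ball 0 R)) (hKP : ∀ z ∈ Metric.ball (0 : ℂ) R, IsKPVolume ι (H z) a Finset.univ)
    (hB : ∀ z ∈ Metric.ball (0 : ℂ) R, ‖locE ι cubes (H z) X‖ ≤ M) :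
    ∃ g : ℂ → ℂ, DifferentiableOn ℂ g (Metric.ball 0 R) ∧ (∀ z ∈ Metric.ball (0 : ℂ) R, ‖g z‖ ≤ M) ∧
      g 0 = locE ι cubes (H 0) X ∧ g 1 = locE ι cubes (H 1) X :=
  ⟨fun z => locE ι cubes (H z) X, differentiableOn_locE_param_of_kp ι cubes X Metric.isOpen_ball hH hKP, hB, rfl, rfl⟩

/-- The one-bond oscillation of the term, read off the interpolant by any disc-to-segment estimate `Φ` (e.g. LEAD w3-20520 g20's Schwarz step
✓`…PolymerAnalyticKnit.norm_sub_le_of_differentiableOn_ball`: `Φ M R = 2M∕R` for `1 < R`) — stated as a transport so that this file imports no `Summits` module.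
[cite: Balaban1987RG1, (1.11)-(1.14) p.262] -/
theorem norm_locE_sub_locE_le_of_interpolant (cubes : Dom → Finset Cube) {H : ℂ → Dom → ℂ} {a : Dom → ℝ} {R M : ℝ} (X : Finset Cube)
    (hH : ∀ Z, DifferentiableOn ℂ (fun z => H z Z) (Metric.ball 0 R)) (hKP : ∀ z ∈ Metric.ball (0 : ℂ) R, IsKPVolume ι (H z) a Finset.univ)
    (hB : ∀ z ∈ Metric.ball (0 : ℂ) R, ‖locE ι cubes (H z) X‖ ≤ M) (Φ : ℝ → ℝ → ℝ)
    (hΦ : ∀ g : ℂ → ℂ, DifferentiableOn ℂ g (Metric.ball 0 R) → (∀ z ∈ Metric.ball (0 : ℂ) R, ‖g z‖ ≤ M) → ‖g 1 - g 0‖ ≤ Φ M R) :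
    ‖locE ι cubes (H 1) X - locE ι cubes (H 0) X‖ ≤ Φ M R :=
  hΦ (fun z => locE ι cubes (H z) X) (differentiableOn_locE_param_of_kp ι cubes X Metric.isOpen_ball hH hKP) hB

end LocE

end Summit.QuantumFields.YangMills.Theorems.FluctuationComparisonRegPrIntLPolymerClusterAnalytic

end
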